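import Literature.AlgebraicGeometry.Resolution.CohenMacaulayCatenary
import Mathlib.RingTheory.Ideal.MinimalPrime.Localization
import HarnessLib

/-!
# Sequences avoiding minimal primes are regular (Cohen–Macaulay local rings)

Topic: `Literature/AlgebraicGeometry/Resolution`. A complement to `CohenMacaulayUnmixed.lean`
(unmixedness, cutting down) and `CohenMacaulayCatenary.lean`: in a Noetherian local ring `(R, 𝔪)`
with a regular sequence in `𝔪` of length `dim R` (a Cohen–Macaulay local ring; e.g. a regular
local ring, `exists_isRegular_length_eq_ringKrullDim`), a sequence `Q₁, …, Q_k ∈ 𝔪` such that each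
`Q_{l+1}` lies in no minimal prime of `(Q₁, …, Q_l)` is an `R`-regular sequence — Matsumura's
Thm. 17.4 (iii) "a subset of a system of parameters is a regular sequence" in the form in which
the avoidance is checked in applications (the heights then being `l` by Krull). PROVED:

* `isRegular_of_forall_notMem_minimalPrimes` — the statement above (induction on `k`: `Q₁` avoids
  `Min R = Ass R` (unmixedness), so it is a non-zero-divisor; `R/Q₁R` is again Cohen–Macaulay of
  dimension `dim R - 1` (cutting down, `ringKrullDim_quotient_span_singleton_succ_eq_ringKrullDim`),
  and the hypothesis descends along `R → R/Q₁R` (`Ideal.minimalPrimes_map_of_surjective`)).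

## Sources

* H. Matsumura, *Commutative Ring Theory*, CUP 1986, Thm. 17.4 [PDF 150]. [Matsumura1987]
* The Stacks Project, Algebra, Tag 00N6 / 02JN (Cohen–Macaulay: s.o.p. are regular). [StacksProject]
-/

noncomputable section

open IsLocalRing RingTheory.Sequence Submodule
open scoped Pointwise

namespace Literature.AlgebraicGeometry.Resolution

universe u

/-- Avoidance hypothesis: each `Q_{l+1}` lies outside every minimal prime of `(Q₁, …, Q_l)`.
[folklore] -/
def AvoidsMinimalPrimes {R : Type u} [CommRing R] (Q : List R) : Prop :=
  ∀ (L₁ : List R) (q : R) (L₂ : List R), Q = L₁ ++ q :: L₂ →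
    ∀ 𝔭 ∈ (Ideal.ofList L₁).minimalPrimes, q ∉ 𝔭

/-- The avoidance hypothesis descends to `R/(q)` for the tail of `q :: Q'`. [folklore] -/
theorem avoidsMinimalPrimes_map_of_cons {R : Type u} [CommRing R] {q : R} {Q' : List R}
    (h : AvoidsMinimalPrimes (q :: Q')) :
    AvoidsMinimalPrimes (Q'.map (Ideal.Quotient.mk (Ideal.span {q}))) := by
  intro M₁ x M₂ hdec 𝔓 h𝔓 hx
  set mk := Ideal.Quotient.mk (Ideal.span {q}) with hmk
  -- invert the decomposition of the mapped list
  obtain ⟨L₁, L, rfl, hL₁, hL⟩ := List.map_eq_append_iff.mp hdec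
  obtain ⟨q', L₂, rfl, hq', hL₂⟩ := List.map_eq_cons_iff.mp hL
  -- minimal primes of `(L₁.map mk)` in `R/(q)` come from minimal primes of `(q :: L₁)` in `R`
  have hof : Ideal.ofList (L₁.map mk) = (Ideal.ofList L₁).map mk := by
    rw [Ideal.map_ofList]
  rw [← hL₁, hof, Ideal.minimalPrimes_map_of_surjective Ideal.Quotient.mk_surjective] at h𝔓
  obtain ⟨𝔭, h𝔭, rfl⟩ := h𝔓
  rw [Ideal.mk_ker] at h𝔭
  have hker : Ideal.span {q} ≤ 𝔭 := le_sup_right.trans h𝔭.1.2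
  have hq'𝔭 : q' ∈ 𝔭 := by
    rw [← hq', hmk, Ideal.mem_map_iff_of_surjective _ Ideal.Quotient.mk_surjective] at hx
    obtain ⟨y, hy, hyq⟩ := hx
    rw [Ideal.Quotient.eq, Ideal.mem_span_singleton'] at hyq
    obtain ⟨a, ha⟩ := hyq
    have : q' = y - a * q := by rw [ha]; ring
    rw [this]
    exact 𝔭.sub_mem hy (𝔭.mul_mem_left a (hker (Ideal.mem_span_singleton_self q)))
  refine h (q :: L₁) q' L₂ (by simp) 𝔭 ?_ hq'𝔭
  -- `(q :: L₁)` generates `(L₁) ⊔ (q)`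
  have e : Ideal.ofList (q :: L₁) = Ideal.ofList L₁ ⊔ Ideal.span {q} := by
    rw [Ideal.ofList_cons, sup_comm]
  rwa [e]

/-- **In a Cohen–Macaulay local ring, sequences avoiding minimal primes are regular** (auxiliary
form, by induction on the length, for all rings at once). [cite: Matsumura1987, Thm. 17.4 (iii)] -/
theorem isRegular_of_forall_notMem_minimalPrimes_aux (k : ℕ) :
    ∀ (R : Type u) [CommRing R] [IsLocalRing R] [IsNoetherianRing R] (rs : List R),
      IsRegular R rs → (∀ r ∈ rs, r ∈ maximalIdeal R) → (rs.length : WithBot ℕ∞) = ringKrullDim R →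
      ∀ Q : List R, Q.length = k → (∀ q ∈ Q, q ∈ maximalIdeal R) → AvoidsMinimalPrimes Q →
      IsRegular R Q := by
  induction k with
  | zero =>
    intro R _ _ _ rs _ _ _ Q hQ _ _
    rw [List.length_eq_zero_iff] at hQ
    subst hQ
    exact IsRegular.nil R R
  | succ k ih =>
    intro R _ _ _ rs hrs hmem hdim Q hQ hQm havoid
    obtain ⟨q, Q', rfl⟩ := List.exists_cons_of_length_eq_add_one hQ
    have hqm : q ∈ maximalIdeal R := hQm q List.mem_cons_self
    -- (1) `q` avoids the minimal primes of `R`, hence is a non-zero-divisor (unmixedness)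
    have hqmin : ∀ 𝔭 ∈ minimalPrimes R, q ∉ 𝔭 := fun 𝔭 h𝔭 =>
      havoid [] q Q' rfl 𝔭 (by rwa [Ideal.ofList_nil])
    have hq0 : q ∈ nonZeroDivisors R := by
      by_contra hx
      have h1 : q ∈ ⋃ p ∈ associatedPrimes R R, (p : Set R) := by
        rw [biUnion_associatedPrimes_eq_compl_nonZeroDivisors]; exact hx
      obtain ⟨p, hp, hxp⟩ := Set.mem_iUnion₂.mp h1
      exact hqmin p (minimalPrimes_of_mem_associatedPrimes hrs hmem hdim hp) hxp
    have hqreg : IsSMulRegular R q := (isRegular_iff_mem_nonZeroDivisors.mpr hq0).left.isSMulRegular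
    -- (2) the Cohen–Macaulay local ring `S = R/(q)`
    obtain ⟨hSnt, hSloc⟩ := isLocalRing_quotient_span_singleton hqm
    set S := R ⧸ Ideal.span {q} with hS
    obtain ⟨rs₁, hlen₁, hmem₁, hreg₁⟩ := exists_isRegular_quotSMulTop hrs hmem hqreg hqm
    obtain ⟨hmem₂, hreg₂⟩ := isRegular_quotient_of_isRegular_quotSMulTop hqm hreg₁ hmem₁
    set rs₂ := rs₁.map (Ideal.Quotient.mk (Ideal.span {q})) with hrs₂
    have hdimS : (rs₂.length : WithBot ℕ∞) = ringKrullDim S := by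
      obtain ⟨m', hm'⟩ := exists_nat_cast_eq_ringKrullDim (R := S)
      have h1 := ringKrullDim_quotient_span_singleton_succ_eq_ringKrullDim hqreg hqm
      rw [← hdim, hm'] at h1
      have h2 : m' + 1 = rs.length := by exact_mod_cast h1
      rw [hm', hrs₂, List.length_map, hlen₁]
      congr 1
      exact_mod_cast (by omega : rs.length - 1 = m')
    -- (3) the tail in `S`
    set Q'' := Q'.map (Ideal.Quotient.mk (Ideal.span {q})) with hQ''
    have hlenQ'' : Q''.length = k := by
      rw [hQ'', List.length_map]; simpa using hQ
    have hQ''m : ∀ x ∈ Q'', x ∈ maximalIdeal S := by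
      intro x hx
      obtain ⟨r₀, hr₀, rfl⟩ := List.mem_map.mp hx
      exact mk_mem_maximalIdeal_quotient hqm (hQm r₀ (List.mem_cons_of_mem q hr₀))
    have hregS : IsRegular S Q'' :=
      ih S rs₂ hreg₂ hmem₂ hdimS Q'' hlenQ'' hQ''m (avoidsMinimalPrimes_map_of_cons havoid)
    -- (4) back to the `R`-module `R/qR`
    have hw : IsWeaklyRegular S Q' := by
      have := (isWeaklyRegular_map_algebraMap_iff S S Q').mp
      rw [Ideal.Quotient.algebraMap_eq] at this
      exact this hregS.toIsWeaklyRegular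
    have heq : (q • (⊤ : Submodule R R)) = Ideal.span {q} := by
      rw [← ideal_span_singleton_smul, smul_eq_mul, Ideal.mul_top]
    let e : QuotSMulTop q R ≃ₗ[R] S := Submodule.quotEquivOfEq _ _ heq
    have hw' : IsWeaklyRegular (QuotSMulTop q R) Q' := (e.isWeaklyRegular_congr Q').mpr hw
    haveI : Nontrivial (QuotSMulTop q R) := nontrivial_quotSMulTop_of_mem_maximalIdeal R hqm
    have hQ'm : ∀ r ∈ Q', r ∈ maximalIdeal R := fun r hr => hQm r (List.mem_cons_of_mem q hr)
    have hreg' : IsRegular (QuotSMulTop q R) Q' :=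
      (IsLocalRing.isRegular_iff_isWeaklyRegular_of_subset_maximalIdeal hQ'm).mpr hw'
    exact (isRegular_cons_iff R q Q').mpr ⟨hqreg, hreg'⟩

/-- **In a Cohen–Macaulay local ring, sequences avoiding minimal primes are regular**: if the
Noetherian local ring `(R, 𝔪)` has a regular sequence in `𝔪` of length `dim R` and
`Q₁, …, Q_k ∈ 𝔪` are such that each `Q_{l+1}` lies in no minimal prime of `(Q₁, …, Q_l)`, then
`Q₁, …, Q_k` is an `R`-regular sequence. [cite: Matsumura1987, Thm. 17.4 (iii)] -/
theorem isRegular_of_forall_notMem_minimalPrimes {R : Type u} [CommRing R] [IsLocalRing R]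
    [IsNoetherianRing R] {rs : List R} (hrs : IsRegular R rs) (hmem : ∀ r ∈ rs, r ∈ maximalIdeal R)
    (hdim : (rs.length : WithBot ℕ∞) = ringKrullDim R) {Q : List R}
    (hQm : ∀ q ∈ Q, q ∈ maximalIdeal R) (havoid : AvoidsMinimalPrimes Q) : IsRegular R Q :=
  isRegular_of_forall_notMem_minimalPrimes_aux Q.length R rs hrs hmem hdim Q rfl hQm havoid

end Literature.AlgebraicGeometry.Resolution
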